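/-
Copyright (c) 2026 the pub-hodgecm-mathlib formalisation cell (harness21).  Prover seat hodgecm-mathlib-K2Liu-p26 (g2): Track B «K2-LIT»,
#184♮ = hLiu418 = stmt-HodgeConjecture-24832; #42S organ S1, (G) organ ROW (ρ-mid), step (M2a-C4-det): THE DETERMINANT OF THE LEVI LETTER — the prefactor
`|det B|^{-1/2}` of ★ (C3) `K2LiuTensorMiddleCellLeviRow` is a function of the Siegel element alone (LEAD F0P6-plan (g14) BATCH #109 (3) ∕ #110; (M2a) inert lead
K2Liu-p01 (g10)).
-/
import Summits.HodgeConjecture.HodgeConjecture.Theorems.K2LiuTensorMiddleCellPointReading   -- ★ (C3-e) `exists_moverReading` (+ the (C2b′) tensor letters)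
import Summits.HodgeConjecture.HodgeConjecture.Theorems.K2LiuWitnessCoordinateLeviRow       -- ★ (C3-κ) `toLin_inv_apply_levi_mulVec`, `halfDiff_eD_symm_iotaD_of_blkC_eq_zero`
import Mathlib.LinearAlgebra.Determinant
import HarnessLib

/-!
# Crux `HLiu418`, #42S organ S1, (G) organ ROW (ρ-mid), step (M2a-C4-det): THE DETERMINANT OF THE LEVI LETTER `B` IS THE `F_v`-DETERMINANT OF THE
# `Δ⁻`-BLOCK — `det (glEquiv B) = det_{F_v}(blkD (matA p) · on (E ⊗ F_v)ⁿ)`, hence `|det B|^{1/2}` depends on `p` alone (not on the implementer, not on the frame)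

Cell `hodgecm-mathlib`, crux item hLiu418 = `stmt-HodgeConjecture-24832`, route of record `HCCMUnconditional`; squad K2 ∕ K2Liu, road `K2_Liu`, socket #42S (a),
organ S1; LEAD F0P6-plan (g14); (M2a) chain (inert lead K2Liu-p01 (g10)): ★ (C3) p862499 §2 writes the middle-cell value with the prefactor
`χ_v(det_Δ(k⊗1)) · (modSqrt (glEquiv B))⁻¹` where `B` is the Levi letter of `k` through the implementer `E′` (`hB : E′·ι′(k⊗1)·E′⁻¹ = transportSp 𝕋′ (m(B))`, ★ (C3-b)
p862528).  For ★ (M2b) §3 `middleRow_of_middleProfiles` the two frames `dV′_±` must produce the SAME factor `g`, so the prefactor must not depend on `E′_±`.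
THEOREMS ONLY (no `def`, no `instance`, no `notation`, no named-fact hypothesis, no `sorry`); lane `--supports stmt-HodgeConjecture-24832` (count-neutral helper).

THE POINT (generic doubled datum `(n, T₀)`, any finite `v`).  Let `E′ ∈ Sp(𝕎^𝔻_v)` be a MOVER (`hEY : E′ ℓ_Δ = ℓ_Y`), `p ∈ P_Δ(F_v)` (`blkC (matA p) = 0`) and `B` with
`E′·ι(p)·E′⁻¹ = transportSp 𝕋 (m(B))`.  The reading `R x := halfDiff(e_D⁻¹(E′⁻¹(x, 0)))` is an `F_v`-LINEAR ISOMORPHISM `X ≃ (Fin n → E ⊗ F_v)` (★ (C3-e)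
`exists_moverReading`: its kernel is `X ∩ E′ℓ_Δ = X ∩ ℓ_Y = 0`), and it INTERTWINES `B` with the `Δ⁻`-block: `R (B·x) = blkD (matA p) ·ᵥ R x` (★ (C3-κ)
`toLin_inv_apply_levi_mulVec` + `halfDiff_eD_symm_iotaD_of_blkC_eq_zero`).  Hence `glEquiv B = R⁻¹ ∘ (blkD (matA p) ·)|_{F_v} ∘ R` and
* §1 **`det_glEquiv_of_leviLetter`**: `LinearMap.det (glEquiv B) = LinearMap.det ((Matrix.toLin' (blkD (matA p))).restrictScalars F_v)` (`LinearMap.det_conj`);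
  **`modSqrt_glEquiv_of_leviLetter`**: `modSqrt (glEquiv B) = √‖det_{F_v}((blkD (matA p)) ·)‖_v` — a function of `p` ALONE.
* §2 (tensor datum `𝕍 ⊗ V′`) **`modSqrt_glEquiv_of_leviLetter_tensor`**: for `k ∈ P_Δ(U(𝕍□)_v)` and the Levi letter at ANY mover `E′` of the big datum,
  `modSqrt (glEquiv B) = √‖det_{F_v}((reindex epsV epsV (blkD (matA k) ⊗ₖ 1)) ·)‖_v` (★ `matA_tensorEmbLoc`, ★ `blk_reindex_kronecker`) — the right-hand side mentions
  neither `E′` nor the frame `dV′` (only `k` and the shared index equivalences `e eW e'`), so the (C3) prefactors of the two inert frames COINCIDE.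
References: [Kudla1994] §3 Thm. 3.1 (`|a(h)|` on the Siegel Levi); [HarrisKudlaSweet1996] §1 (1.11), (1.15)–(1.16); [Rangarao1993] Lemma 3.2 (3.8);
[MoeglinVignerasWaldspurger1987] Chap. 2 II.2, II.6.
HONEST LABEL.  Count-neutral helper; it retires nothing by itself: `HC_CM` is proved only modulo the 7 printed citations (2 remaining named inputs:
hLiu418 = `stmt-HodgeConjecture-24832`, h413 = `stmt-HodgeConjecture-24833`) until rung 0 closes.

## References
* [Kudla1994] S. S. Kudla, *Splitting metaplectic covers of dual reductive pairs*, Israel J. Math. 87 (1994), §3 Thm. 3.1.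
* [HarrisKudlaSweet1996] M. Harris, S. Kudla, W. J. Sweet, J. Amer. Math. Soc. 9 (1996), §1 (1.11), (1.15)–(1.16).
* [Rangarao1993] R. Ranga Rao, Pacific J. Math. 157 (1993), Lemma 3.2 (3.8).
* [MoeglinVignerasWaldspurger1987] C. Mœglin, M.-F. Vignéras, J.-L. Waldspurger, LNM 1291 (1987), Chap. 2 II.2, II.6.
-/

set_option autoImplicit false
set_option linter.dupNamespace false -- the mandated namespace repeats `HodgeConjecture.HodgeConjecture`

noncomputable section

open scoped Matrix Kronecker
open NumberField IsDedekindDomain Matrix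
open Literature.RepresentationTheory.HeisenbergGroup Literature.RepresentationTheory.HeisenbergGroup.SymplecticMatrix
open Literature.NumberTheory.Automorphic Literature.NumberTheory.Automorphic.UnitaryGroup Literature.NumberTheory.Weil1964
open Literature.NumberTheory.GaloisRepresentations Literature.NumberTheory.GaloisRepresentations.IsNonarchimedeanLocalField
open Literature.NumberTheory.GelbartRogawski1991 Literature.NumberTheory.GelbartRogawski1991.GRConstruction
open Literature.NumberTheory.GelbartRogawski1991.AdaptedBlocks
open Literature.NumberTheory.GelbartRogawski1991.UnitaryDualPair
open Literature.NumberTheory.GelbartRogawski1991.UnitaryDualPair.LocalSplitting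
open Literature.NumberTheory.K2Lit.SiegelDoubled
open Summit.HodgeConjecture.HodgeConjecture.Cruxes.HLiu418.K2LiuLocalSWSectionDefs
open Summit.HodgeConjecture.HodgeConjecture.Cruxes.HLiu418.K2LiuLocalSWTensorAdaptedBlocks
open Summit.HodgeConjecture.HodgeConjecture.Cruxes.HLiu418.K2LiuTensorMiddleCellPointReading
open Summit.HodgeConjecture.HodgeConjecture.Cruxes.HLiu418.K2LiuWitnessCoordinateLeviRow

namespace Summit.HodgeConjecture.HodgeConjecture.Cruxes.HLiu418.K2LiuLeviLetterDeterminant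

/-! ## §1 Generic doubled datum: `det (glEquiv B)` is the `F_v`-determinant of the `Δ⁻`-block -/

section Doubled

variable (F : Type) [Field F] [NumberField F] (E : Type) [Field E] [NumberField E] [Algebra F E] [Algebra.IsQuadraticExtension F E]
  (c : E ≃ₐ[F] E) {δ : E} (hcδ : c δ = -δ) (hδ : δ ≠ 0) {d : F} (hd : δ * δ = algebraMap F E d)
  (v : HeightOneSpectrum (𝓞 F)) (n : ℕ) {T₀ : Matrix (Fin n) (Fin n) F} (hT₀ : T₀.IsSymm)
  {JD : Matrix (Fin (n + n)) (Fin (n + n)) E} (hJD : JD = (gramD F n T₀).map (algebraMap F E))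

/-- bridge: `toLin E′⁻¹ w = (↑E′)⁻¹ w = (↑E′).symm w` (the group inverse of `Sp(𝕎)` is the inverse linear equivalence). [folklore] -/
theorem toLin_inv_eq_symm_apply {N : ℕ} {T : Matrix (Fin N) (Fin N) F} (E' : LocalSp F N T v)
    (w : (Fin N → v.adicCompletion F) × (Fin N → v.adicCompletion F)) :
    toLin F v E'⁻¹ w =
      ((E' : LocalSp F N T v) : ((Fin N → v.adicCompletion F) × (Fin N → v.adicCompletion F)) ≃ₗ[v.adicCompletion F]
        ((Fin N → v.adicCompletion F) × (Fin N → v.adicCompletion F))).symm w := by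
  dsimp only [LocalSplitting.toLin]
  rw [LinearEquiv.coe_coe, Subgroup.coe_inv, LinearEquiv.coe_inv]

/-- **(C4-det) THE DETERMINANT OF THE LEVI LETTER.**  For a mover `E′` (`hEY : E′ ℓ_Δ = ℓ_Y`), a Siegel element `p` (`blkC (matA p) = 0`) and `B` with the Levi
letter `E′·ι(p)·E′⁻¹ = transportSp 𝕋 (m(B))`: `det (glEquiv B) = det_{F_v}(blkD (matA p) acting on (E ⊗ F_v)ⁿ)` — the reading `x ↦ halfDiff(e_D⁻¹(E′⁻¹(x,0)))`
(an `F_v`-linear isomorphism, ★ (C3-e) `exists_moverReading`) conjugates `B` into the `Δ⁻`-block (★ (C3-κ)), and `det` is conjugation invariant (`LinearMap.det_conj`).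
[cite: Kudla1994, §3 Thm. 3.1] [cite: HarrisKudlaSweet1996, §1 (1.11)] [cite: MoeglinVignerasWaldspurger1987, Chap. 2 II.2] -/
theorem det_glEquiv_of_leviLetter (hTv : IsUnit (localGram F (n + n) (gramD F n T₀) v).det) (E' : LocalSp F (n + n) (gramD F n T₀) v)
    (hEY : (deltaLagrangian F v n).map (toLin F v E') = lagrangianY F (n + n) v)
    (p : UnitaryGroup.localPi E c (n + n) JD v) (hp : blkC (matA F E c v n p) = 0)
    (B : GL (Fin (n + n)) (v.adicCompletion F))
    (hB : E' * iotaD F E c hcδ hδ hd v n hT₀ hJD p * E'⁻¹ = transportSp (localGram F (n + n) (gramD F n T₀) v) hTv (levi B)) :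
    LinearMap.det ((glEquiv B : (Fin (n + n) → v.adicCompletion F) ≃ₗ[v.adicCompletion F] (Fin (n + n) → v.adicCompletion F)) :
        (Fin (n + n) → v.adicCompletion F) →ₗ[v.adicCompletion F] (Fin (n + n) → v.adicCompletion F)) =
      LinearMap.det ((Matrix.toLin' (blkD (matA F E c v n p))).restrictScalars (v.adicCompletion F)) := by
  -- the reading `R` (an `F_v`-linear isomorphism) and its intertwining relation
  obtain ⟨R, hR⟩ := exists_moverReading F E c hcδ hδ hd v n E' hEY
  have hconj : ∀ x : Fin (n + n) → v.adicCompletion F,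
      R (((B : GL (Fin (n + n)) (v.adicCompletion F)) : Matrix (Fin (n + n)) (Fin (n + n)) (v.adicCompletion F)) *ᵥ x) =
        blkD (matA F E c v n p) *ᵥ R x := by
    intro x
    rw [hR, hR, ← toLin_inv_eq_symm_apply F v E', ← toLin_inv_eq_symm_apply F v E',
      toLin_inv_apply_levi_mulVec F E c hcδ hδ hd v n hT₀ hJD hTv E' p B hB x,
      halfDiff_eD_symm_iotaD_of_blkC_eq_zero F E c hcδ hδ hd v n hT₀ hJD p hp]
  -- `glEquiv B = R⁻¹ ∘ (blkD (matA p) ·)|_{F_v} ∘ R`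
  have key : ((glEquiv B : (Fin (n + n) → v.adicCompletion F) ≃ₗ[v.adicCompletion F] (Fin (n + n) → v.adicCompletion F)) :
        (Fin (n + n) → v.adicCompletion F) →ₗ[v.adicCompletion F] (Fin (n + n) → v.adicCompletion F)) =
      (R.toLinearEquiv.symm : (Fin n → LocalRing E v) →ₗ[v.adicCompletion F] (Fin (n + n) → v.adicCompletion F)) ∘ₗ
        ((Matrix.toLin' (blkD (matA F E c v n p))).restrictScalars (v.adicCompletion F)) ∘ₗ
        (R.toLinearEquiv.symm.symm : (Fin (n + n) → v.adicCompletion F) →ₗ[v.adicCompletion F] (Fin n → LocalRing E v)) := by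
    apply LinearMap.ext
    intro x
    simp only [LinearMap.coe_comp, Function.comp_apply, LinearEquiv.coe_coe, LinearEquiv.symm_symm, LinearMap.coe_restrictScalars, Matrix.toLin'_apply,
      glEquiv_apply]
    rw [LinearEquiv.eq_symm_apply]
    exact hconj x
  rw [key]
  exact LinearMap.det_conj _ _

/-- **`|det B|^{1/2}` IS A FUNCTION OF THE SIEGEL ELEMENT ALONE**: `modSqrt (glEquiv B) = √‖det_{F_v}(blkD (matA p) ·)‖_v` (§1 in ★ `modSqrt`'s definition).
[cite: Rangarao1993, Lemma 3.2 (3.8), p. 351] [cite: Kudla1994, §3 Thm. 3.1] -/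
theorem modSqrt_glEquiv_of_leviLetter (hTv : IsUnit (localGram F (n + n) (gramD F n T₀) v).det) (E' : LocalSp F (n + n) (gramD F n T₀) v)
    (hEY : (deltaLagrangian F v n).map (toLin F v E') = lagrangianY F (n + n) v)
    (p : UnitaryGroup.localPi E c (n + n) JD v) (hp : blkC (matA F E c v n p) = 0)
    (B : GL (Fin (n + n)) (v.adicCompletion F))
    (hB : E' * iotaD F E c hcδ hδ hd v n hT₀ hJD p * E'⁻¹ = transportSp (localGram F (n + n) (gramD F n T₀) v) hTv (levi B)) :
    modSqrt (glEquiv B) =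
      Real.sqrt (normAbs (v.adicCompletion F) (LinearMap.det ((Matrix.toLin' (blkD (matA F E c v n p))).restrictScalars (v.adicCompletion F)))) := by
  rw [modSqrt, det_glEquiv_of_leviLetter F E c hcδ hδ hd v n hT₀ hJD hTv E' hEY p hp B hB]

end Doubled

/-! ## §2 The tensor datum `𝕍 ⊗ V′`: the prefactor in the letters of `k` alone -/

section Tensor

variable (L : Type) [Field L] [NumberField L] [IsCMField L]
variable {N M : ℕ} (e : Fin N × Fin M ≃ Fin 2)
  (dV : Fin N → L) (hdV : ∀ i, IsCMField.complexConj L (dV i) = dV i)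
  (dW : Fin M → L) (hdW : ∀ i, IsCMField.complexConj L (dW i) = dW i)
variable {M₂ M' n' : ℕ} (eW : Fin M × Fin M₂ ≃ Fin M') (e' : Fin N × Fin M' ≃ Fin n')
  (dV' : Fin M₂ → L) (hdV' : ∀ k, IsCMField.complexConj L (dV' k) = dV' k)
  (v : HeightOneSpectrum (𝓞 (Fp L)))

/-- **(C4-det) AT THE TENSOR DATUM**: for `k ∈ P_Δ(U(𝕍□)_v)`, ANY mover `E′` of the big datum `𝕍 ⊗ V′` and the Levi letter `hB` of `k ⊗ 1` through `E′`,
`modSqrt (glEquiv B) = √‖det_{F_v}((reindex epsV epsV (blkD (matA k) ⊗ₖ 1)) ·)‖_v` — the right-hand side depends on `k` and the shared index equivalences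
`e eW e'` only (neither on `E′` nor on the frame `dV′`): the (C3) prefactors of the two inert frames coincide.
[cite: Kudla1994, §3 Thm. 3.1] [cite: HarrisKudlaSweet1996, §1 (1.11), (1.15)–(1.16)] [cite: Rangarao1993, Lemma 3.2 (3.8), p. 351] -/
theorem modSqrt_glEquiv_of_leviLetter_tensor
    (hTv : IsUnit (localGram (Fp L) (n' + n') (gramD (Fp L) n' (gramR L e' dV hdV (tensorFrame L dW eW dV') (tensorFrame_real L dW hdW eW dV' hdV'))) v).det)
    (E' : LocalSp (Fp L) (n' + n') (gramD (Fp L) n' (gramR L e' dV hdV (tensorFrame L dW eW dV') (tensorFrame_real L dW hdW eW dV' hdV'))) v)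
    (hEY : (deltaLagrangian (Fp L) v n').map (toLin (Fp L) v E') = lagrangianY (Fp L) (n' + n') v)
    (k : UnitaryGroup.localPi L (IsCMField.complexConj L) (2 + 2) (hermD L e dV hdV dW hdW) v)
    (hk : IsSiegelDelta (Fp L) L (IsCMField.complexConj L) (complexConj_imagUnit L) (imagUnit_ne_zero L) (imagUnit_mul_self L) v 2
      (gramR_isSymm L e dV hdV dW hdW) (hermD_eq_map_gramD L e dV hdV dW hdW) k)
    (B : GL (Fin (n' + n')) (v.adicCompletion (Fp L)))
    (hB : E' * iotaD (Fp L) L (IsCMField.complexConj L) (complexConj_imagUnit L) (imagUnit_ne_zero L) (imagUnit_mul_self L) v n'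
        (gramR_isSymm L e' dV hdV (tensorFrame L dW eW dV') (tensorFrame_real L dW hdW eW dV' hdV'))
        (hermD_eq_map_gramD L e' dV hdV (tensorFrame L dW eW dV') (tensorFrame_real L dW hdW eW dV' hdV'))
        (tensorEmbLoc L e dV hdV dW hdW eW e' dV' hdV' v k) * E'⁻¹ =
      transportSp (localGram (Fp L) (n' + n') (gramD (Fp L) n' (gramR L e' dV hdV (tensorFrame L dW eW dV') (tensorFrame_real L dW hdW eW dV' hdV'))) v) hTv (levi B)) :
    modSqrt (glEquiv B) =
      Real.sqrt (normAbs (v.adicCompletion (Fp L)) (LinearMap.det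
        ((Matrix.toLin' (Matrix.reindex (epsV e eW e') (epsV e eW e')
          (blkD (matA (Fp L) L (IsCMField.complexConj L) v 2 k) ⊗ₖ (1 : Matrix (Fin M₂) (Fin M₂) (LocalRing L v))))).restrictScalars
            (v.adicCompletion (Fp L))))) := by
  haveI : Algebra.IsQuadraticExtension (Fp L) L := IsCMField.isQuadraticExtension L
  -- `k ⊗ 1` is a Siegel element of the big datum and its `Δ⁻`-block is `reindex epsV (blkD (matA k) ⊗ 1)`
  have hC : blkC (matA (Fp L) L (IsCMField.complexConj L) v n' (tensorEmbLoc L e dV hdV dW hdW eW e' dV' hdV' v k)) = 0 :=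
    (isSiegelDelta_iff_blkC_eq_zero (Fp L) L (IsCMField.complexConj L) (complexConj_imagUnit L) (imagUnit_ne_zero L) (imagUnit_mul_self L) v n'
      (gramR_isSymm L e' dV hdV (tensorFrame L dW eW dV') (tensorFrame_real L dW hdW eW dV' hdV'))
      (hermD_eq_map_gramD L e' dV hdV (tensorFrame L dW eW dV') (tensorFrame_real L dW hdW eW dV' hdV')) _).1
      (isSiegelDelta_tensorEmbLoc L e dV hdV dW hdW eW e' dV' hdV' v hk)
  have hD : blkD (matA (Fp L) L (IsCMField.complexConj L) v n' (tensorEmbLoc L e dV hdV dW hdW eW e' dV' hdV' v k)) =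
      Matrix.reindex (epsV e eW e') (epsV e eW e') (blkD (matA (Fp L) L (IsCMField.complexConj L) v 2 k) ⊗ₖ (1 : Matrix (Fin M₂) (Fin M₂) (LocalRing L v))) := by
    rw [matA_tensorEmbLoc]
    exact (blk_reindex_kronecker (epsV e eW e') (matA (Fp L) L (IsCMField.complexConj L) v 2 k) (1 : Matrix (Fin M₂) (Fin M₂) (LocalRing L v))).2.2.2
  rw [modSqrt_glEquiv_of_leviLetter (Fp L) L (IsCMField.complexConj L) (complexConj_imagUnit L) (imagUnit_ne_zero L) (imagUnit_mul_self L) v n'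
    (gramR_isSymm L e' dV hdV (tensorFrame L dW eW dV') (tensorFrame_real L dW hdW eW dV' hdV'))
    (hermD_eq_map_gramD L e' dV hdV (tensorFrame L dW eW dV') (tensorFrame_real L dW hdW eW dV' hdV')) hTv E' hEY _ hC B hB, hD]

end Tensor

end Summit.HodgeConjecture.HodgeConjecture.Cruxes.HLiu418.K2LiuLeviLetterDeterminant

end
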